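import Mathlib
import Literature.NumberTheory.Transcendental.ZagierDilogarithmConjecture
import HarnessLib

/-!
# `ZagierDilogarithmConjecture` (stmt-KontsevichZagierPeriods-10550) — line
`kummer-clausen-linearisation` (reshape c2, "Galois descent"), stub `stub_cyclotomicSigned`

**Monomial (signed-permutation-with-signs) symmetry for cyclotomic points.** Let `ζ = exp(2πi/N)`
(`N ≥ 1`) and let `zᵢ = Σₘ qᵢₘ ζᵐ` (`qᵢₘ ∈ ℚ`, `m < N`) be points of `ℚ(ζ)` with integer coefficients
`nᵢ`. Suppose that for every `j` coprime to `N` the Galois-twisted family `(Σₘ qᵢₘ ζ^{jm})ᵢ` is MONOMIAL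
over `β = Σ nᵢ[zᵢ]` through the second and third alternatives: there are `e ∈ ℤ` and a permutation `π`
with, for every `i`, `Σₘ qᵢₘ ζ^{jm} = z_{πi}` and `nᵢ = e·n_{πi}`, or `Σₘ qᵢₘ ζ^{jm} = z̄_{πi}` and
`nᵢ = −e·n_{πi}`. Then for every `ℚ`-algebra map `σ : ℚ̄ → ℂ` (`ℚ̄ = algebraicClosure ℚ ℂ ⊆ ℂ`) and the
lifts `wᵢ, w'ᵢ ∈ ℚ̄` of `zᵢ, z̄ᵢ`, each of the families `(σ wᵢ)ᵢ`, `(σ w'ᵢ)ᵢ` is monomial over `β` — the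
MONOMIAL property consumed by `stub_monomialSymmetric` (we only ever produce the last two alternatives,
never the "real point" one). This is the signed refinement of `stub_cyclotomicPoints` (constant sign),
needed because `ℍ⁺`-normalised Galois orbits carry per-index signs (e.g. `[ζ₇] + [ζ₇²] − [ζ₇³]`).

Proof. `ζ` is a primitive `N`-th root of unity (`Complex.isPrimitiveRoot_exp`), algebraic (root of
`X ^ N − 1`), so it lifts to `Z ∈ ℚ̄`, again a primitive `N`-th root; `σ Z` is a primitive `N`-th root in
`ℂ`, hence `σ Z = ζ ^ j` with `j` coprime to `N` (`IsPrimitiveRoot.isPrimitiveRoot_iff`). In coordinates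
`wᵢ = Σₘ qᵢₘ Zᵐ`, so `σ wᵢ = Σₘ qᵢₘ ζ^{jm}` and the hypothesis at `j` gives the claim for the first
family. Since `ζ̄ = ζ⁻¹ = ζ^{N−1}`, `z̄ᵢ = Σₘ qᵢₘ ζ^{(N−1)m}`, `w'ᵢ = Σₘ qᵢₘ Z^{(N−1)m}` and
`σ w'ᵢ = Σₘ qᵢₘ ζ^{(j(N−1))m}`; the hypothesis at `j(N−1)` (coprime to `N`) gives the claim for the
second family. The elementary cyclotomic bookkeeping (`ζ̄ = ζ^{N−1}`, conjugating / evaluating `σ` on a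
`ℚ`-combination of powers) is the content of the `cyclo_*` helpers of the sibling file
`…StubCyclotomicPoints`; it is re-derived inline here (that module was not importable at the time of
writing: farm build lag) rather than restated. Mathlib only; sorry-free;
axioms ⊆ {propext, Classical.choice, Quot.sound}.
-/

noncomputable section

open scoped BigOperators ComplexConjugate
open Literature.NumberTheory.Transcendental

namespace Summit.KontsevichZagierPeriods.HyperbolicBloch.ZagierDilogarithmGaloisDescent

/-- **Stub `stub_cyclotomicSigned` (monomial symmetry for signed-orbit-symmetric cyclotomic
configurations).** For `ζ = exp(2πi/N)`, points `zᵢ = Σₘ qᵢₘ ζᵐ ∈ ℚ(ζ)` with coefficients `nᵢ ∈ ℤ` such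
that for every `j` coprime to `N` there are `e ∈ ℤ` and a permutation `π` with, for every `i`,
`Σₘ qᵢₘ ζ^{jm} = z_{πi} ∧ nᵢ = e n_{πi}` or `Σₘ qᵢₘ ζ^{jm} = z̄_{πi} ∧ nᵢ = -e n_{πi}`, and every
`ℚ`-algebra map `σ : ℚ̄ → ℂ` with lifts `wᵢ, w'ᵢ ∈ ℚ̄` of `zᵢ, z̄ᵢ`: each family `(σ wᵢ)ᵢ`, `(σ w'ᵢ)ᵢ` is
monomial over `Σ nᵢ[zᵢ]` (some `e, π` with, per index, `σ uᵢ` real and `e n_{πi} = 0`, or `σ uᵢ = z_{πi}`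
and `nᵢ = e n_{πi}`, or `σ uᵢ = z̄_{πi}` and `nᵢ = -e n_{πi}`). (`σ` sends the lift of `ζ` to `ζ ^ j`, `j`
coprime to `N`; apply the hypothesis at `j` and at `j (N - 1)`.) [folklore] -/
theorem stub_cyclotomicSigned :
    ∀ (N : ℕ), 0 < N → ∀ (k : ℕ) (z : Fin k → ℂ) (n : Fin k → ℤ) (q : Fin k → Fin N → ℚ),
      (∀ i, z i = ∑ m : Fin N, (q i m : ℂ) *
        Complex.exp (2 * Real.pi * Complex.I / N) ^ (m : ℕ)) →
      (∀ j : ℕ, j.Coprime N → ∃ (e : ℤ) (π : Equiv.Perm (Fin k)), ∀ i,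
          ((∑ m : Fin N, (q i m : ℂ) * Complex.exp (2 * Real.pi * Complex.I / N) ^ (j * (m : ℕ))) =
              z (π i) ∧ n i = e * n (π i)) ∨
          ((∑ m : Fin N, (q i m : ℂ) * Complex.exp (2 * Real.pi * Complex.I / N) ^ (j * (m : ℕ))) =
              conj (z (π i)) ∧ n i = -(e * n (π i)))) →
        ∀ (σ : ↥(algebraicClosure ℚ ℂ) →ₐ[ℚ] ℂ) (w w' : Fin k → ↥(algebraicClosure ℚ ℂ)),
          (∀ i, (w i : ℂ) = z i) → (∀ i, (w' i : ℂ) = conj (z i)) →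
          (∃ (e : ℤ) (π : Equiv.Perm (Fin k)), ∀ i,
              ((σ (w i)).im = 0 ∧ e * n (π i) = 0) ∨ (σ (w i) = z (π i) ∧ n i = e * n (π i)) ∨
                (σ (w i) = conj (z (π i)) ∧ n i = -(e * n (π i)))) ∧
          (∃ (e : ℤ) (π : Equiv.Perm (Fin k)), ∀ i,
              ((σ (w' i)).im = 0 ∧ e * n (π i) = 0) ∨ (σ (w' i) = z (π i) ∧ n i = e * n (π i)) ∨
                (σ (w' i) = conj (z (π i)) ∧ n i = -(e * n (π i)))) := by
  intro N hN k z n q hz hH σ w w' hw hw'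
  haveI : NeZero N := ⟨hN.ne'⟩
  -- `ζ = exp (2πi/N)` is a primitive `N`-th root of unity; abstract it
  have hζ : IsPrimitiveRoot (Complex.exp (2 * Real.pi * Complex.I / N)) N :=
    Complex.isPrimitiveRoot_exp N hN.ne'
  generalize Complex.exp (2 * Real.pi * Complex.I / N) = ζ at hz hH hζ
  -- `N - 1` is coprime to `N`, and `ζ̄ = ζ⁻¹ = ζ ^ (N - 1)`
  have hcop : (N - 1).Coprime N :=
    (Nat.coprime_self_sub_left (Nat.succ_le_of_lt hN)).2 (Nat.coprime_one_left N)
  have hconj : conj ζ = ζ ^ (N - 1) := by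
    rw [← Complex.inv_eq_conj (hζ.norm'_eq_one hN.ne')]
    exact inv_eq_of_mul_eq_one_right (by rw [mul_pow_sub_one hN.ne', hζ.pow_eq_one])
  -- hence `z̄ᵢ = Σₘ qᵢₘ ζ^{(N-1)m}`
  have hzconj : ∀ i, conj (z i) = ∑ m : Fin N, (q i m : ℂ) * ζ ^ ((N - 1) * (m : ℕ)) :=
      fun i => by
    rw [hz i, map_sum]
    refine Finset.sum_congr rfl fun m _ => ?_
    rw [map_mul, map_ratCast, map_pow, hconj, ← pow_mul]
  -- `ζ` is algebraic; its lift `Z ∈ ℚ̄` is a primitive `N`-th root, and `σ Z = ζ ^ j`, `j` coprime to `N`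
  have hζa : IsAlgebraic ℚ ζ := by
    refine ⟨Polynomial.X ^ N - Polynomial.C 1, Polynomial.X_pow_sub_C_ne_zero hN 1, ?_⟩
    simp [hζ.pow_eq_one]
  obtain ⟨Z, hZ⟩ : ∃ Z : ↥(algebraicClosure ℚ ℂ), (Z : ℂ) = ζ :=
    ⟨⟨ζ, mem_algebraicClosure_iff.2 hζa⟩, rfl⟩
  have hZp : IsPrimitiveRoot Z N := by
    refine IsPrimitiveRoot.of_map_of_injective (f := (algebraicClosure ℚ ℂ).val) ?_
      (algebraicClosure ℚ ℂ).val.toRingHom.injective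
    show IsPrimitiveRoot (Z : ℂ) N
    rw [hZ]
    exact hζ
  obtain ⟨j, -, hj, hσZ⟩ := hζ.isPrimitiveRoot_iff.1 (hZp.map_of_injective σ.toRingHom.injective)
  have hσZ' : σ Z = ζ ^ j := hσZ.symm
  -- `σ` on a `ℚ`-combination of powers of `Z`: `σ (Σₘ qᵢₘ Z ^ (e m)) = Σₘ qᵢₘ ζ ^ (j * e m)`
  have hσsum : ∀ (i : Fin k) (e : Fin N → ℕ),
      σ (∑ m : Fin N, ((q i m : ℚ) : ↥(algebraicClosure ℚ ℂ)) * Z ^ e m) =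
        ∑ m : Fin N, (q i m : ℂ) * ζ ^ (j * e m) := fun i e => by
    rw [map_sum]
    refine Finset.sum_congr rfl fun m _ => ?_
    rw [map_mul, map_ratCast, map_pow, hσZ', ← pow_mul]
  -- the lifts in coordinates: `wᵢ = Σₘ qᵢₘ Zᵐ`, `w'ᵢ = Σₘ qᵢₘ Z^{(N-1)m}`
  have hwZ : ∀ i, w i = ∑ m : Fin N, ((q i m : ℚ) : ↥(algebraicClosure ℚ ℂ)) * Z ^ (m : ℕ) :=
    fun i => Subtype.ext (by
      push_cast
      rw [hw i, hz i, hZ])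
  have hw'Z : ∀ i, w' i =
      ∑ m : Fin N, ((q i m : ℚ) : ↥(algebraicClosure ℚ ℂ)) * Z ^ ((N - 1) * (m : ℕ)) :=
    fun i => Subtype.ext (by
      push_cast
      rw [hw' i, hzconj i, hZ])
  -- hence `σ wᵢ = Σₘ qᵢₘ ζ^{jm}` and `σ w'ᵢ = Σₘ qᵢₘ ζ^{(j(N-1))m}`
  have hσw : ∀ i, σ (w i) = ∑ m : Fin N, (q i m : ℂ) * ζ ^ (j * (m : ℕ)) := fun i => by
    rw [hwZ i, hσsum i (fun m => (m : ℕ))]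
  have hσw' : ∀ i, σ (w' i) = ∑ m : Fin N, (q i m : ℂ) * ζ ^ (j * (N - 1) * (m : ℕ)) :=
    fun i => by
    rw [hw'Z i, hσsum i (fun m => (N - 1) * (m : ℕ))]
    simp only [mul_assoc]
  have hj' : (j * (N - 1)).Coprime N := hj.mul_left hcop
  -- the signed hypothesis at `j` (first family) and at `j (N - 1)` (second family)
  refine ⟨?_, ?_⟩
  · obtain ⟨e, π, hπ⟩ := hH j hj
    exact ⟨e, π, fun i => Or.inr ((hπ i).imp (fun h => ⟨(hσw i).trans h.1, h.2⟩)
      (fun h => ⟨(hσw i).trans h.1, h.2⟩))⟩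
  · obtain ⟨e, π, hπ⟩ := hH (j * (N - 1)) hj'
    exact ⟨e, π, fun i => Or.inr ((hπ i).imp (fun h => ⟨(hσw' i).trans h.1, h.2⟩)
      (fun h => ⟨(hσw' i).trans h.1, h.2⟩))⟩

end Summit.KontsevichZagierPeriods.HyperbolicBloch.ZagierDilogarithmGaloisDescent

end
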